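import Mathlib.MeasureTheory.Integral.Prod
import Mathlib.MeasureTheory.Integral.IntervalIntegral.IntegrationByParts
import Mathlib.Analysis.SpecialFunctions.Integrals.Basic
import Mathlib.MeasureTheory.Integral.DominatedConvergence
import HarnessLib

/-!
# The one-sided convolution of continuous complex functions on the half-line

Topic `Literature/Analysis/Convolution`. The tree's `OneSidedConvolution.lean` develops the half-line convolution algebra for
REAL locally bounded measurable functions (`oconv f g x = ∫_{(0,x]} f(t) g(x − t) dt`); the renewal/Volterra files of the
Laplace route (`RenewalResolventSymbol.lean`, `RenewalResolventPole.lean`) use COMPLEX continuous functions and the interval-integral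
form `(a ⋆ b)(t) = ∫₀ᵗ a(t − u) b(u) du` (Schiff 1999, §2.7). This file supplies that algebra (everything PROVED):

* `hconv a b t := ∫ u in 0..t, a (t − u) * b u` (`def`), continuity in `t` for continuous `a, b` (`continuous_hconv`);
* commutativity `hconv_comm`, bilinearity (`hconv_add_left/right`, `hconv_sub_left/right`, `hconv_const_mul_left`),
  locality `hconv_congr` (the value at `t ≥ 0` only sees `a, b` on `[0, t]`);
* **associativity** `hconv_assoc` on `t ≥ 0` (Fubini on the triangle `{0 ≤ u ≤ w ≤ t}` + translation, Schiff §2.7 (ii));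
* the growth bound `norm_hconv_le` : `‖a‖ ≤ A e^{αt}`, `‖b‖ ≤ B e^{αt}` on `t ≥ 0` ⇒ `‖(a ⋆ b)(t)‖ ≤ A B t e^{αt}`.

NOT here: Laplace transforms (`Literature/Analysis/Complex/LaplaceHalfLine*.lean`), the resolvent (next files).
-/

noncomputable section

open _root_.MeasureTheory _root_.Set _root_.Filter _root_.Real intervalIntegral
open scoped _root_.Topology

namespace Literature.Analysis.Convolution

/-- The one-sided convolution of two functions on the half-line, interval-integral form:
`(a ⋆ b)(t) = ∫₀ᵗ a(t − u) b(u) du`. [cite: Schiff1999, §2.7 (definition of the convolution)] -/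
def hconv (a b : ℝ → ℂ) (t : ℝ) : ℂ := ∫ u in (0 : ℝ)..t, a (t - u) * b u

variable {a b c : ℝ → ℂ}

/-- Unfolding lemma. [cite: Schiff1999, §2.7 (definition of the convolution)] -/
theorem hconv_def (a b : ℝ → ℂ) (t : ℝ) : hconv a b t = ∫ u in (0 : ℝ)..t, a (t - u) * b u := rfl

/-- `(a ⋆ b)(0) = 0`. [cite: Schiff1999, §2.7 (definition of the convolution)] -/
theorem hconv_zero (a b : ℝ → ℂ) : hconv a b 0 = 0 := by
  simp [hconv]

/-- **Commutativity** `(a ⋆ b)(t) = (b ⋆ a)(t)` (substitution `u ↦ t − u`). [cite: Schiff1999, §2.7 (commutativity)] -/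
theorem hconv_comm (a b : ℝ → ℂ) (t : ℝ) : hconv a b t = hconv b a t := by
  rw [hconv, hconv]
  have h := intervalIntegral.integral_comp_sub_left (fun v => a v * b (t - v)) t (a := 0) (b := t)
  simp only [sub_sub_cancel, sub_self, sub_zero] at h
  rw [h]
  refine intervalIntegral.integral_congr fun u _ => ?_
  ring

/-- **Locality**: for `t ≥ 0`, `(a ⋆ b)(t)` only depends on `a, b` restricted to `[0, t]`.
[cite: Schiff1999, §2.7 (definition of the convolution)] -/
theorem hconv_congr {a a' b b' : ℝ → ℂ} {t : ℝ} (ht : 0 ≤ t) (ha : ∀ u ∈ Icc 0 t, a u = a' u)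
    (hb : ∀ u ∈ Icc 0 t, b u = b' u) : hconv a b t = hconv a' b' t := by
  rw [hconv, hconv]
  refine intervalIntegral.integral_congr fun u hu => ?_
  rw [uIcc_of_le ht] at hu
  rw [ha (t - u) ⟨by linarith [hu.2], by linarith [hu.1]⟩, hb u hu]

/-- The convolution integrand is interval-integrable for continuous data. [cite: Schiff1999, §2.7] -/
theorem intervalIntegrable_integrand (ha : Continuous a) (hb : Continuous b) (t x y : ℝ) :
    IntervalIntegrable (fun u => a (t - u) * b u) volume x y :=
  ((ha.comp (continuous_const.sub continuous_id)).mul hb).intervalIntegrable x y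

/-- Additivity in the first factor. [cite: Schiff1999, §2.7 (iii)] -/
theorem hconv_add_left (ha : Continuous a) (hb : Continuous b) (hc : Continuous c) (t : ℝ) :
    hconv (fun u => a u + b u) c t = hconv a c t + hconv b c t := by
  simp only [hconv, add_mul]
  exact intervalIntegral.integral_add (intervalIntegrable_integrand ha hc t 0 t) (intervalIntegrable_integrand hb hc t 0 t)

/-- Additivity in the second factor. [cite: Schiff1999, §2.7 (iii)] -/
theorem hconv_add_right (ha : Continuous a) (hb : Continuous b) (hc : Continuous c) (t : ℝ) :
    hconv a (fun u => b u + c u) t = hconv a b t + hconv a c t := by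
  simp only [hconv, mul_add]
  exact intervalIntegral.integral_add (intervalIntegrable_integrand ha hb t 0 t) (intervalIntegrable_integrand ha hc t 0 t)

/-- Subtractivity in the first factor. [cite: Schiff1999, §2.7 (iii)] -/
theorem hconv_sub_left (ha : Continuous a) (hb : Continuous b) (hc : Continuous c) (t : ℝ) :
    hconv (fun u => a u - b u) c t = hconv a c t - hconv b c t := by
  simp only [hconv, sub_mul]
  exact intervalIntegral.integral_sub (intervalIntegrable_integrand ha hc t 0 t) (intervalIntegrable_integrand hb hc t 0 t)

/-- Subtractivity in the second factor. [cite: Schiff1999, §2.7 (iii)] -/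
theorem hconv_sub_right (ha : Continuous a) (hb : Continuous b) (hc : Continuous c) (t : ℝ) :
    hconv a (fun u => b u - c u) t = hconv a b t - hconv a c t := by
  simp only [hconv, mul_sub]
  exact intervalIntegral.integral_sub (intervalIntegrable_integrand ha hb t 0 t) (intervalIntegrable_integrand ha hc t 0 t)

/-- Homogeneity. [cite: Schiff1999, §2.7 (i)] -/
theorem hconv_const_mul_left (κ : ℂ) (a b : ℝ → ℂ) (t : ℝ) :
    hconv (fun u => κ * a u) b t = κ * hconv a b t := by
  simp only [hconv]
  rw [← intervalIntegral.integral_const_mul]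
  refine intervalIntegral.integral_congr fun u _ => ?_
  ring

/-- **Continuity** of `t ↦ (a ⋆ b)(t)` for continuous `a, b`. [cite: Schiff1999, §2.7 / Theorem 2.39 (proof)] -/
theorem continuous_hconv (ha : Continuous a) (hb : Continuous b) : Continuous (hconv a b) := by
  have h : Continuous (Function.uncurry fun (t u : ℝ) => a (t - u) * b u) := by
    exact (ha.comp (continuous_fst.sub continuous_snd)).mul (hb.comp continuous_snd)
  exact intervalIntegral.continuous_parametric_intervalIntegral_of_continuous (a₀ := 0) h continuous_id

/-- **Growth bound**: `‖a(t)‖ ≤ A e^{αt}`, `‖b(t)‖ ≤ B e^{αt}` on `t ≥ 0` give `‖(a ⋆ b)(t)‖ ≤ A B t e^{αt}` for `t ≥ 0`.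
[cite: Schiff1999, Theorem 2.39 (proof)] -/
theorem norm_hconv_le {A B α : ℝ}
    (hA : ∀ t, 0 ≤ t → ‖a t‖ ≤ A * Real.exp (α * t)) (hB : ∀ t, 0 ≤ t → ‖b t‖ ≤ B * Real.exp (α * t))
    {t : ℝ} (ht : 0 ≤ t) : ‖hconv a b t‖ ≤ A * B * t * Real.exp (α * t) := by
  have hA0 : 0 ≤ A := by simpa using (norm_nonneg _).trans (hA 0 le_rfl)
  rw [hconv]
  have hle : ∀ u ∈ Icc 0 t, ‖a (t - u) * b u‖ ≤ A * B * Real.exp (α * t) := by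
    intro u hu
    rw [norm_mul]
    calc ‖a (t - u)‖ * ‖b u‖ ≤ (A * Real.exp (α * (t - u))) * (B * Real.exp (α * u)) :=
          mul_le_mul (hA _ (by linarith [hu.2])) (hB u hu.1) (norm_nonneg _) (by positivity)
      _ = A * B * Real.exp (α * t) := by
          rw [mul_mul_mul_comm, ← Real.exp_add]; ring_nf
  calc ‖∫ u in (0 : ℝ)..t, a (t - u) * b u‖ ≤ (A * B * Real.exp (α * t)) * |t - 0| :=
        intervalIntegral.norm_integral_le_of_norm_le_const fun u hu => hle u (by
          rw [uIoc_of_le ht] at hu; exact ⟨hu.1.le, hu.2⟩)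
    _ = A * B * t * Real.exp (α * t) := by rw [sub_zero, abs_of_nonneg ht]; ring

/-! ### Fubini on the triangle and associativity -/

/-- **Fubini on a triangle** for a continuous complex integrand: for `0 ≤ X`,
`∫₀^X (∫₀^w K(u,w) du) dw = ∫₀^X (∫ᵤ^X K(u,w) dw) du`. [cite: Schiff1999, §2.7 (ii) (proof: «having reversed the order of
integration»)] -/
theorem integral_triangle_swap {K : ℝ → ℝ → ℂ} (hK : Continuous (Function.uncurry K)) {X : ℝ} (hX : 0 ≤ X) :
    ∫ w in (0 : ℝ)..X, ∫ u in (0 : ℝ)..w, K u w = ∫ u in (0 : ℝ)..X, ∫ w in u..X, K u w := by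
  -- work with the finite measure `μ = volume|_(0,X]` and the indicator of `{u ≤ w}`
  set μ : Measure ℝ := volume.restrict (Ioc 0 X) with hμ
  haveI : IsFiniteMeasure μ := ⟨by rw [hμ, Measure.restrict_apply_univ]; exact measure_Ioc_lt_top⟩
  set F : ℝ → ℝ → ℂ := fun w u => if u ≤ w then K u w else 0 with hF
  -- a bound for `K` on the square
  obtain ⟨M, hM⟩ := (isCompact_Icc.prod isCompact_Icc : IsCompact (Icc (0 : ℝ) X ×ˢ Icc (0 : ℝ) X)).exists_bound_of_continuousOn
    hK.continuousOn
  have hFm : Measurable (Function.uncurry F) := by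
    have h1 : Measurable fun z : ℝ × ℝ => K z.2 z.1 := hK.measurable.comp measurable_swap
    have : Function.uncurry F = {z : ℝ × ℝ | z.2 ≤ z.1}.indicator fun z => K z.2 z.1 := by
      funext z; simp only [Function.uncurry, hF, Set.indicator, Set.mem_setOf_eq]
    rw [this]
    exact h1.indicator (measurableSet_le measurable_snd measurable_fst)
  have hFi : Integrable (Function.uncurry F) (μ.prod μ) := by
    refine Integrable.of_bound hFm.aestronglyMeasurable (max M 0) ?_
    rw [Measure.ae_prod_iff_ae_ae]
    · rw [hμ, ae_restrict_iff' measurableSet_Ioc]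
      refine Eventually.of_forall fun w hw => ?_
      rw [ae_restrict_iff' measurableSet_Ioc]
      refine Eventually.of_forall fun u hu => ?_
      simp only [Function.uncurry, hF]
      split_ifs
      · exact (hM (u, w) ⟨⟨hu.1.le, hu.2⟩, ⟨hw.1.le, hw.2⟩⟩).trans (le_max_left _ _)
      · simp
    · exact measurableSet_le hFm.norm.stronglyMeasurable.measurable measurable_const
  have hswap := integral_integral_swap hFi
  -- identify the two sides
  have hL : ∫ w in (0 : ℝ)..X, ∫ u in (0 : ℝ)..w, K u w = ∫ w, ∫ u, F w u ∂μ ∂μ := by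
    rw [intervalIntegral.integral_of_le hX]
    refine setIntegral_congr_fun measurableSet_Ioc fun w hw => ?_
    have h1 : (fun u => F w u) = (Iic w).indicator fun u => K u w := by
      funext u; simp only [hF, Set.indicator, mem_Iic]
    rw [h1, MeasureTheory.integral_indicator measurableSet_Iic, hμ, Measure.restrict_restrict measurableSet_Iic,
      intervalIntegral.integral_of_le hw.1.le]
    congr 1
    congr 1
    ext u; simp only [mem_inter_iff, mem_Iic, mem_Ioc]
    constructor
    · rintro ⟨h1, h2⟩; exact ⟨h2, h1, h2.trans hw.2⟩
    · rintro ⟨h2, h3, _⟩; exact ⟨h3, h2⟩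
  have hR : ∫ u in (0 : ℝ)..X, ∫ w in u..X, K u w = ∫ u, ∫ w, F w u ∂μ ∂μ := by
    rw [intervalIntegral.integral_of_le hX]
    refine setIntegral_congr_fun measurableSet_Ioc fun u hu => ?_
    have h1 : (fun w => F w u) = (Ici u).indicator fun w => K u w := by
      funext w; simp only [hF, Set.indicator, mem_Ici]
    rw [h1, MeasureTheory.integral_indicator measurableSet_Ici, hμ, Measure.restrict_restrict measurableSet_Ici,
      intervalIntegral.integral_of_le hu.2]
    have hset : Ici u ∩ Ioc 0 X = Icc u X := by
      ext w; simp only [mem_inter_iff, mem_Ici, mem_Ioc, mem_Icc]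
      constructor
      · rintro ⟨h1, _, h3⟩; exact ⟨h1, h3⟩
      · rintro ⟨h1, h2⟩; exact ⟨h1, hu.1.trans_le h1, h2⟩
    rw [hset]
    exact setIntegral_congr_set Ioc_ae_eq_Icc
  rw [hL, hR, hswap]

/-- **Associativity** `((a ⋆ b) ⋆ c)(t) = (a ⋆ (b ⋆ c))(t)` for `t ≥ 0` and continuous `a, b, c`.
[cite: Schiff1999, §2.7 (ii) (associative property)] -/
theorem hconv_assoc (ha : Continuous a) (hb : Continuous b) (hc : Continuous c) {t : ℝ} (ht : 0 ≤ t) :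
    hconv (hconv a b) c t = hconv a (hconv b c) t := by
  -- `(a ⋆ (b ⋆ c))(t) = ∫₀ᵗ ∫₀ʷ a(t−w) b(w−u) c(u) du dw`; swap; translate `w = u + v`
  have hK : Continuous (Function.uncurry fun (u w : ℝ) => a (t - w) * b (w - u) * c u) := by
    refine ((ha.comp (continuous_const.sub continuous_snd)).mul
      (hb.comp (continuous_snd.sub continuous_fst))).mul (hc.comp continuous_fst)
  have hrhs : hconv a (hconv b c) t = ∫ w in (0 : ℝ)..t, ∫ u in (0 : ℝ)..w, a (t - w) * b (w - u) * c u := by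
    rw [hconv]
    refine intervalIntegral.integral_congr fun w _ => ?_
    simp only [hconv]
    rw [← intervalIntegral.integral_const_mul]
    refine intervalIntegral.integral_congr fun u _ => ?_
    ring
  have hlhs : hconv (hconv a b) c t = ∫ u in (0 : ℝ)..t, ∫ w in u..t, a (t - w) * b (w - u) * c u := by
    rw [hconv]
    refine intervalIntegral.integral_congr fun u hu => ?_
    rw [uIcc_of_le ht] at hu
    simp only [hconv]
    -- `∫_u^t a(t−w) b(w−u) c(u) dw = (∫₀^{t−u} a(t−u−v) b(v) dv)·c(u)` by `w = v + u`
    have h := intervalIntegral.integral_comp_add_right (fun w => a (t - w) * b (w - u) * c u) u (a := 0) (b := t - u)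
    simp only [zero_add, sub_add_cancel] at h
    rw [← intervalIntegral.integral_mul_const, ← h]
    refine intervalIntegral.integral_congr fun v _ => ?_
    simp only [add_sub_cancel_right]
    ring_nf
  rw [hlhs, hrhs, integral_triangle_swap hK ht]

end Literature.Analysis.Convolution
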